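import Summits.KontsevichZagierPeriods.KontsevichZagierPeriods.Theorems.HurwitzMicroSectorsNormalFormPrincipleLevelOne
import Summits.KontsevichZagierPeriods.KontsevichZagierPeriods.Theorems.HurwitzMicroSectorsNormalFormPrincipleSlabASubPtK20
import Summits.KontsevichZagierPeriods.KontsevichZagierPeriods.Theorems.HurwitzMicroSectorsNormalFormPrincipleAlgCarriers
import Summits.KontsevichZagierPeriods.KontsevichZagierPeriods.Theorems.HurwitzMicroSectorsNormalFormPrincipleM2FiveZetaTwo
import Literature.NumberTheory.Transcendental.BoxIntegralZetaValues
import Literature.Barriers.KontsevichZagierPeriods.GrothendieckPeriodConjectureDependenceOddZetaProofs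

/-!
# `NormalFormPrinciple` (stmt-KontsevichZagierPeriods-3869), line `SketchIdeator1` — leaf `stub_boxRigidity`:
# the even zeta values layer: the even zeta values are rigid over `ℚ̄`

Pure number theory (stub Z5 of the even zeta values layer, lead seat c8; `--supports` the crux).
If `q + Σ_{k ∈ S} βₖ ζ(2(k+1)) = 0` with real algebraic `q, βₖ`, then `q = 0` and `βₖ = 0` for
every `k ∈ S`.

Proof. Euler: `ζ(2(k+1)) = rₖ π^{2(k+1)}` with `rₖ ∈ ℚ`, `rₖ ≠ 0` (the tree's
`Literature.Barriers.KontsevichZagierPeriods.exists_rat_ne_zero_zetaValue_two_mul_eq`, from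
Mathlib's `hasSum_zeta_nat` and `ζ(2k) > 0`). Let `K := Subalgebra.algebraicClosure ℚ ℝ` be the
ring of real algebraic numbers. `π` is transcendental over `ℚ` (Lindemann; the tree's proved
`Literature.NumberTheory.Transcendental.transcendental_pi_holds`), hence over the algebraic
extension `K` of `ℚ` (Mathlib `Transcendental.subalgebraAlgebraicClosure`). The polynomial
`P := C q + Σ_{k ∈ S} C (βₖ rₖ) X^{2(k+1)} ∈ K[X]` satisfies `aeval π P = 0` by the hypothesis, so
`P = 0`; its coefficients `q` (degree `0`) and `βₖ rₖ` (degrees `2(k+1)`, pairwise distinct and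
non-zero) therefore vanish, whence `q = 0` and, as `rₖ ≠ 0`, `βₖ = 0`.

References: M. Kontsevich, D. Zagier, *Periods* (2001), §1.2; J. Fresán, *Une introduction aux
périodes* (2024), Ex. 2.6 (Euler, Lindemann). No new definitions.
-/

noncomputable section

open MeasureTheory Set
open Literature.NumberTheory.Transcendental Literature.NumberTheory.Transcendental.KZ
open Literature.ModelTheory.ExponentialFields (IsSemialgebraic)

namespace Summit.KontsevichZagierPeriods.HurwitzMicroSectors.NormalFormPrinciple.PiBox.EvenZeta

open Polynomial in
/-- **Reading off coefficients.** Over a commutative semiring, the polynomial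
`C c + Σ_{k ∈ S} C (a k) X^{2(k+1)}` has constant coefficient `c` and, for `j ∈ S`, coefficient
`a j` in degree `2(j+1)` (the degrees `2(k+1)`, `k ∈ S`, are pairwise distinct and non-zero).
[folklore] -/
theorem ez_coeff_C_add_sum {K : Type*} [CommSemiring K] (S : Finset ℕ) (c : K) (a : ℕ → K) :
    (C c + ∑ k ∈ S, C (a k) * X ^ (2 * (k + 1))).coeff 0 = c ∧
      ∀ j ∈ S, (C c + ∑ k ∈ S, C (a k) * X ^ (2 * (k + 1))).coeff (2 * (j + 1)) = a j := by
  refine ⟨?_, fun j hj => ?_⟩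
  · rw [coeff_add, coeff_C_zero, finsetSum_coeff, Finset.sum_eq_zero, add_zero]
    intro k _
    rw [coeff_C_mul_X_pow, if_neg (by omega)]
  · rw [coeff_add, coeff_C, if_neg (by omega), zero_add, finsetSum_coeff,
      Finset.sum_eq_single j, coeff_C_mul_X_pow, if_pos rfl]
    · intro k _ hkj
      rw [coeff_C_mul_X_pow, if_neg (by omega)]
    · intro hj'
      exact absurd hj hj'

open Polynomial in
/-- **No non-trivial relation `c + Σ_{k ∈ S} aₖ x^{2(k+1)} = 0` at a transcendental point.** For a
subalgebra `K ⊆ ℝ` over `ℚ` and `x ∈ ℝ` transcendental over `K`, a vanishing sum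
`c + Σ_{k ∈ S} aₖ x^{2(k+1)} = 0` with `c, aₖ ∈ K` has `c = 0` and `aₖ = 0` for `k ∈ S`: it is
`aeval x P = 0` for `P := C c + Σ C aₖ X^{2(k+1)} ∈ K[X]`, so `P = 0` (Mathlib
`transcendental_iff`) and the coefficients vanish (`ez_coeff_C_add_sum`). [folklore] -/
theorem ez_eq_zero_of_transcendental (K : Subalgebra ℚ ℝ) {x : ℝ} (hx : Transcendental K x)
    (S : Finset ℕ) (c : K) (a : ℕ → K)
    (h : (c : ℝ) + ∑ k ∈ S, (a k : ℝ) * x ^ (2 * (k + 1)) = 0) :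
    c = 0 ∧ ∀ k ∈ S, a k = 0 := by
  have heval : aeval x (C c + ∑ k ∈ S, C (a k) * X ^ (2 * (k + 1))) =
      (c : ℝ) + ∑ k ∈ S, (a k : ℝ) * x ^ (2 * (k + 1)) := by
    rw [map_add, map_sum, aeval_C, Subalgebra.algebraMap_apply]
    refine congrArg _ (Finset.sum_congr rfl fun k _ => ?_)
    rw [map_mul, aeval_C, Subalgebra.algebraMap_apply, aeval_X_pow]
  have hP0 : C c + ∑ k ∈ S, C (a k) * X ^ (2 * (k + 1)) = 0 :=
    (transcendental_iff.1 hx) _ (heval.trans h)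
  obtain ⟨hc0, hcS⟩ := ez_coeff_C_add_sum S c a
  rw [hP0] at hc0 hcS
  exact ⟨by rw [← hc0, coeff_zero], fun k hk => by rw [← hcS k hk, coeff_zero]⟩

/-- **Stub Z5 (the even zeta values are rigid over `ℚ̄`):** `q + Σ_{k∈S} βₖ ζ(2(k+1)) = 0` with
real-algebraic `q, βₖ` forces `q = 0` and `βₖ = 0` (`ζ(2k) = rₖ π^{2k}`, `rₖ ∈ ℚ^×` by Euler and
`ζ(2k) > 0`; `π` is transcendental by Lindemann, hence transcendental over the ring
`Subalgebra.algebraicClosure ℚ ℝ` of real algebraic numbers, so no non-zero polynomial with real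
algebraic coefficients vanishes at `π`). [cite: KontsevichZagier2001, §1.2] -/
theorem even_zeta_rigid (S : Finset ℕ) (β : ℕ → ℝ) (q : ℝ) (hβ : ∀ k ∈ S, IsAlgebraic ℚ (β k))
    (hq : IsAlgebraic ℚ q) (h : q + ∑ k ∈ S, β k * zetaValue (2 * (k + 1)) = 0) :
    q = 0 ∧ ∀ k ∈ S, β k = 0 := by
  -- Euler: `ζ(2(k+1)) = r k · π ^ (2(k+1))` with `r k ∈ ℚ`, `r k ≠ 0`
  have hE : ∀ k : ℕ, ∃ r : ℚ, r ≠ 0 ∧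
      zetaValue (2 * (k + 1)) = (r : ℝ) * Real.pi ^ (2 * (k + 1)) := fun k =>
    Literature.Barriers.KontsevichZagierPeriods.exists_rat_ne_zero_zetaValue_two_mul_eq
      (Nat.succ_ne_zero k)
  choose r hr0 hr using hE
  -- Lindemann: `π` is transcendental over `ℚ`, hence over the real algebraic numbers
  have hpi : Transcendental ℚ Real.pi := transcendental_pi_holds
  have hpiK : Transcendental (Subalgebra.algebraicClosure ℚ ℝ) Real.pi :=
    hpi.subalgebraAlgebraicClosure
  -- the algebraic data `q`, `β k · r k` as real algebraic numbers
  obtain ⟨c, hc⟩ : ∃ c : Subalgebra.algebraicClosure ℚ ℝ, (c : ℝ) = q :=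
    ⟨⟨q, (Subalgebra.mem_algebraicClosure ℚ ℝ).2 hq⟩, rfl⟩
  obtain ⟨a, ha⟩ : ∃ a : ℕ → Subalgebra.algebraicClosure ℚ ℝ,
      ∀ k ∈ S, (a k : ℝ) = β k * r k :=
    ⟨fun k => if hk : k ∈ S then
        ⟨β k * r k, (Subalgebra.mem_algebraicClosure ℚ ℝ).2
          ((hβ k hk).mul (isAlgebraic_rat ℚ (r k)))⟩
      else 0,
      fun k hk => by simp [dif_pos hk]⟩
  -- the relation, rewritten at `π`
  have hsum : ∑ k ∈ S, (a k : ℝ) * Real.pi ^ (2 * (k + 1)) =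
      ∑ k ∈ S, β k * zetaValue (2 * (k + 1)) :=
    Finset.sum_congr rfl fun k hk => by rw [ha k hk, hr k, mul_assoc]
  have hrel : (c : ℝ) + ∑ k ∈ S, (a k : ℝ) * Real.pi ^ (2 * (k + 1)) = 0 := by
    rw [hc, hsum]
    exact h
  obtain ⟨hc0, ha0⟩ := ez_eq_zero_of_transcendental _ hpiK S c a hrel
  refine ⟨?_, fun k hk => ?_⟩
  · rw [← hc, hc0, ZeroMemClass.coe_zero]
  · have h2 : β k * (r k : ℝ) = 0 := by rw [← ha k hk, ha0 k hk, ZeroMemClass.coe_zero]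
    rcases mul_eq_zero.1 h2 with h3 | h3
    · exact h3
    · exact absurd (Rat.cast_eq_zero.1 h3) (hr0 k)

end Summit.KontsevichZagierPeriods.HurwitzMicroSectors.NormalFormPrinciple.PiBox.EvenZeta

end
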